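import Summits.QuantumFields.YangMills.Theorems.UnitScaleTiltProp7TwistedOneStepLinL1
import Summits.QuantumFields.YangMills.Theorems.UnitScaleTiltProp7TwistedOneStepDefectCovGauge
import HarnessLib

/-!
# Route `UnitScaleTilt`, crux K1 «MinimiserStabilityRegPr» (stmt-QuantumFields-19200), route-R E′ (A′) «HCOW-VIA-Σ» (★★OWNER RULING g28-№13), package P-A2 «JOINT-Σ»,
# row F2″-COV (★p1 g17 NAMER WORD 16 (c)), FILE D — **THE ℓ¹ DAMPING OF THE COVARIANT ONE-STEP LINEARISATION AT LEVEL `l` OF THE TOWER OF A PLAQUETTE-SMALL SU(2)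
# BACKGROUND**: `V := Ū₀ˡ = emlIterU l U₀♭`, `PlaqSmall a₀ U₀`, `s_B := 2d(3L^{l+1} − 1)a₀`, `s₀ := 30ℓLˡ·s_B`, budgets `6400ℓ²Lˡs_B ≤ 1`, `10⁷ℓ²ρ ≤ 1`, `4s₀ < ρ`:
# `Σ_c ‖(∂_y|₀ f_V · Y)(c)‖ ≤ (L·L^{−d} + 16·(12Lρ)∕ρ²·(2s₀)·(2d))·Σ_b ‖Y b‖` — FILE C ★★★`sum_norm_fderiv_dbarChartField_apply_le` in routeR-w6 g7's CLUSTER AXIAL GAUGES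
# (✓`Prop7TwistedOneStepDefectCovGauge.norm_bgTower_gauged_sub_one_le_of_plaqSmall`: the background tower is bond-small on the two blocks of `c` in the cluster axial gauge at `c₋`).

Cell `ym3-torus`, D-0154 (3c) twin-width seat `ym-routeR-w3` (gen 7).  YM₃ on T³ is a ladder rung (R3), NOT the Clay problem; nothing here is a claim about the stub, the crux,
d = 4 or the mass gap.  `--supports stmt-QuantumFields-19200 --as helper`; count-neutral; def-free.  The letters (background `emlIterU l (unitsField (toUField U₀))`, the one-step chart
INLINE, `PlaqSmall a₀ U₀`, `l + 2 ≤ m + K`, `s_B`, `hbud₀`) are routeR-w6 g7's F1″ COV-GAUGE letters VERBATIM, so that the F1″ defect row and this F2″ damping row instantiate at the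
member (`RegPr F n K ε₀ U₀` ⇒ `PlaqSmall (regThreshold F n K ε₀) U₀`, px15 g3's numerals) side by side; the per-level `κ_l` here is what px18 g3's ✓`Prop7CovLogTower.l1_CmapTwS_le_damped_defects`
consumes as `hT` (after the member's uniform bound `κ_l ≤ κ`, `l < K − n`).

WHAT THIS FILE PROVES (sorry-free, no definition; SU(2), `M₂(ℂ)` with the `L²`-operator norm).
* `norm_transfUp_toUnits_le_one` — the coherent lifts of an SU(2) gauge are norm-`≤ 1` together with their inverses (✓`transfUp_toUnits_mem_U1`).
* ★★★ **`sum_norm_fderiv_dbarChartField_apply_le_of_plaqSmall`** — the row above (FILE C at `V₀ := Ū₀ˡ`, `û_c := transfUp (axialT U₀ (embIter (l+1) c₋))♭ l`, `s_B := s₀`).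
* `differentiableAt_dbarChartField_zero_of_plaqSmall` — the field-valued one-step chart at `Ū₀ˡ` is differentiable at `0` (F0″'s `hdiff`∕`hf`; also ✓routeR-w6's `differentiableAt_chart_zero_of_plaqSmall`).
HONEST SCOPE.  Instantiation only; constants crude, L-only after the member's numerals (`a₀ = ε₀L^{−2(K−n)}`, `l + 1 ≤ K − n` ⇒ `Lˡ·s_B ≤ 6d·ε₀∕L`, so `4s₀ < ρ := (10⁷ℓ²)⁻¹` is an
L-only `ε₀`-window and `κ_l ≤ L^{1−d}·(1 + c(L)·ε₀)` uniformly in `l`).  Nothing of P-A2, hcoW, E′, EX or the crux is claimed.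

References: T. Bałaban, CMP **98** (1985) 17–51 [Balaban1985Averaging] ((11)–(12) p.19, (89) p.31, (125)–(127) p.36, (161)–(163) p.42, p.44); CMP **95** (1984) 17–40
[Balaban1984PropagatorsI] ((1.18)–(1.20) pp.19–20); CMP **102** (1985) 277–309 [Balaban1985Variational] ((44)–(46) p.285).
-/

noncomputable section

open scoped BigOperators Matrix.Norms.L2Operator
open NormedSpace Metric Set Finset

namespace Summit.QuantumFields.YangMills.Theorems.Prop7TwistedOneStepLinL1OfPlaqSmall

open Literature.MathematicalPhysics.QuantumFieldTheory.Balaban1983to89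
open T4Continuum BlockAveraging AveragingRT ExpMeanLog LatticeFieldCalculus
open B15DeterminingSets (embIter)
open B7Prop1Explicit (expUnit val_expUnit U1 mem_U1)
open MatrixLog (mlog)
open B10Eq27TorusAxialLog (axialT gaugeActT gaugeActT_apply unitsField toUField suIncl)
open Summit.QuantumFields.YangMills.Theorems.Prop8Chart (emlAvgU emlIterU)
open Summit.QuantumFields.YangMills.Theorems.Prop7SymAvgTwSym (dbarCovU)
open Summit.QuantumFields.YangMills.Theorems.Prop7TwistedOneStepDefectCovGauge (transfUp_toUnits_mem_U1 norm_bgTower_gauged_sub_one_le_of_plaqSmall)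
open Summit.QuantumFields.YangMills.Theorems.Prop7TwistedOneStepLinL1 (sum_norm_fderiv_dbarChartField_apply_le differentiableAt_dbarChartField_zero)

variable {P : Params}

/-- The coherent lifts `transfUp û l` of an SU(2) gauge `û = (suIncl ∘ u)` are norm-`≤ 1` with norm-`≤ 1` inverses (`U1`-valued, ✓`transfUp_toUnits_mem_U1`). [cite: Balaban1985Averaging, (11)–(12) p.19] -/
theorem norm_transfUp_toUnits_le_one (u : GaugeTransf P 0 (Matrix.specialUnitaryGroup (Fin 2) ℂ)) (i : ℕ) (w : Site P i) :
    ‖((transfUp (fun x => Unitary.toUnits (suIncl (u x)) : GaugeTransf P 0 (Matrix (Fin 2) (Fin 2) ℂ)ˣ) i w : (Matrix (Fin 2) (Fin 2) ℂ)ˣ) : Matrix (Fin 2) (Fin 2) ℂ)‖ ≤ 1 ∧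
    ‖(((transfUp (fun x => Unitary.toUnits (suIncl (u x)) : GaugeTransf P 0 (Matrix (Fin 2) (Fin 2) ℂ)ˣ) i w)⁻¹ : (Matrix (Fin 2) (Fin 2) ℂ)ˣ) : Matrix (Fin 2) (Fin 2) ℂ)‖ ≤ 1 :=
  mem_U1.1 (transfUp_toUnits_mem_U1 u i w)

/-- ★★★ **THE ℓ¹ DAMPING OF THE COVARIANT ONE-STEP LINEARISATION AT LEVEL `l` OF THE TOWER OF A PLAQUETTE-SMALL SU(2) BACKGROUND.**  `V := Ū₀ˡ = emlIterU l U₀♭`,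
`PlaqSmall a₀ U₀`, `s_B := 2d(3L^{l+1} − 1)a₀`, `s₀ := 30ℓLˡs_B`, budgets `6400ℓ²Lˡs_B ≤ 1`, `10⁷ℓ²ρ ≤ 1`, `4s₀ < ρ`; then for every `Y`
`Σ_c ‖(fderiv ℂ (y ↦ (c ↦ log[U̿(V; e^{y}V)(c)·Ū(V)(c)⁻¹])) 0 Y) c‖ ≤ (L·L^{−d} + 16·(12Lρ)∕ρ²·(2s₀)·(2d))·Σ_b ‖Y b‖` (FILE C in the cluster axial gauges at `c₋` of
✓`norm_bgTower_gauged_sub_one_le_of_plaqSmall`). [cite: Balaban1985Averaging, (11)–(12) p.19, (125)–(127) p.36, (161)–(163) p.42, p.44; Balaban1984PropagatorsI, (1.18)–(1.20) pp.19–20] -/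
theorem sum_norm_fderiv_dbarChartField_apply_le_of_plaqSmall {l : ℕ} (hl : l + 2 ≤ P.m + P.K) (U₀ : GaugeField P 0 (Matrix.specialUnitaryGroup (Fin 2) ℂ))
    {a₀ : ℝ} (ha₀ : 0 < a₀) (hU : PlaqSmall a₀ U₀)
    (hbud₀ : 6400 * (((P.d + 2) * P.L : ℕ) : ℝ) ^ 2 * (P.L : ℝ) ^ l * (2 * ((P.d : ℝ) * (3 * (P.L : ℝ) ^ (l + 1) - 1)) * a₀) ≤ 1)
    {ρ : ℝ} (hρ0 : 0 < ρ) (hbudget : 10000000 * (((P.d + 2) * P.L : ℕ) : ℝ) ^ 2 * ρ ≤ 1)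
    (hs₀ρ : 4 * (30 * (((P.d + 2) * P.L : ℕ) : ℝ) * (P.L : ℝ) ^ l * (2 * ((P.d : ℝ) * (3 * (P.L : ℝ) ^ (l + 1) - 1)) * a₀)) < ρ)
    (Y : PBond P l → Matrix (Fin 2) (Fin 2) ℂ) :
    ∑ c : PBond P (l + 1), ‖(fderiv ℂ (fun (y : PBond P l → Matrix (Fin 2) (Fin 2) ℂ) (c : PBond P (l + 1)) =>
        mlog (((dbarCovU (emlIterU l (unitsField (toUField U₀))) (fun b => expUnit (y b) * emlIterU l (unitsField (toUField U₀)) b) c :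
            (Matrix (Fin 2) (Fin 2) ℂ)ˣ) : Matrix (Fin 2) (Fin 2) ℂ) *
          (((emlAvgU (emlIterU l (unitsField (toUField U₀))) c)⁻¹ : (Matrix (Fin 2) (Fin 2) ℂ)ˣ) : Matrix (Fin 2) (Fin 2) ℂ))) 0 Y) c‖ ≤
      ((P.L : ℝ) * ((P.L : ℝ) ^ P.d)⁻¹ +
          16 * (12 * (P.L : ℝ) * ρ) / ρ ^ 2 * (2 * (30 * (((P.d + 2) * P.L : ℕ) : ℝ) * (P.L : ℝ) ^ l * (2 * ((P.d : ℝ) * (3 * (P.L : ℝ) ^ (l + 1) - 1)) * a₀))) *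
            (2 * P.d)) * ∑ b : PBond P l, ‖Y b‖ := by
  have hL1 : (1 : ℝ) ≤ P.L := by exact_mod_cast P.L_pos
  have hsB0 : 0 ≤ 30 * (((P.d + 2) * P.L : ℕ) : ℝ) * (P.L : ℝ) ^ l * (2 * ((P.d : ℝ) * (3 * (P.L : ℝ) ^ (l + 1) - 1)) * a₀) := by
    have h3 : (0 : ℝ) ≤ 3 * (P.L : ℝ) ^ (l + 1) - 1 := by linarith [one_le_pow₀ (n := l + 1) hL1]
    have ha := ha₀.le
    positivity
  exact sum_norm_fderiv_dbarChartField_apply_le (n := Fin 2) (by omega) (emlIterU l (unitsField (toUField U₀)))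
    (fun c => transfUp (fun x => Unitary.toUnits (suIncl (axialT U₀ (embIter (l + 1) c.src) x)) : GaugeTransf P 0 (Matrix (Fin 2) (Fin 2) ℂ)ˣ) l)
    (fun c x => (norm_transfUp_toUnits_le_one _ l x).1) (fun c x => (norm_transfUp_toUnits_le_one _ l x).2) hρ0 hbudget hsB0 hs₀ρ
    (fun c b h1 h2 => norm_bgTower_gauged_sub_one_le_of_plaqSmall hl U₀ ha₀ hU hbud₀ c b h1 h2) Y

/-- **THE FIELD-VALUED ONE-STEP CHART AT `Ū₀ˡ` IS DIFFERENTIABLE AT `0`** under the same budgets (F0″'s `hdiff`∕`hf`). [cite: Balaban1985Averaging, (127) p.36; Balaban1987RG1, (0.4) p.253] -/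
theorem differentiableAt_dbarChartField_zero_of_plaqSmall {l : ℕ} (hl : l + 2 ≤ P.m + P.K) (U₀ : GaugeField P 0 (Matrix.specialUnitaryGroup (Fin 2) ℂ))
    {a₀ : ℝ} (ha₀ : 0 < a₀) (hU : PlaqSmall a₀ U₀)
    (hbud₀ : 6400 * (((P.d + 2) * P.L : ℕ) : ℝ) ^ 2 * (P.L : ℝ) ^ l * (2 * ((P.d : ℝ) * (3 * (P.L : ℝ) ^ (l + 1) - 1)) * a₀) ≤ 1)
    {ρ : ℝ} (hρ0 : 0 < ρ) (hbudget : 10000000 * (((P.d + 2) * P.L : ℕ) : ℝ) ^ 2 * ρ ≤ 1)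
    (hs₀ρ : 4 * (30 * (((P.d + 2) * P.L : ℕ) : ℝ) * (P.L : ℝ) ^ l * (2 * ((P.d : ℝ) * (3 * (P.L : ℝ) ^ (l + 1) - 1)) * a₀)) < ρ) :
    DifferentiableAt ℂ (fun (y : PBond P l → Matrix (Fin 2) (Fin 2) ℂ) (c : PBond P (l + 1)) =>
        mlog (((dbarCovU (emlIterU l (unitsField (toUField U₀))) (fun b => expUnit (y b) * emlIterU l (unitsField (toUField U₀)) b) c :
            (Matrix (Fin 2) (Fin 2) ℂ)ˣ) : Matrix (Fin 2) (Fin 2) ℂ) *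
          (((emlAvgU (emlIterU l (unitsField (toUField U₀))) c)⁻¹ : (Matrix (Fin 2) (Fin 2) ℂ)ˣ) : Matrix (Fin 2) (Fin 2) ℂ))) 0 := by
  have hL1 : (1 : ℝ) ≤ P.L := by exact_mod_cast P.L_pos
  have hsB0 : 0 ≤ 30 * (((P.d + 2) * P.L : ℕ) : ℝ) * (P.L : ℝ) ^ l * (2 * ((P.d : ℝ) * (3 * (P.L : ℝ) ^ (l + 1) - 1)) * a₀) := by
    have h3 : (0 : ℝ) ≤ 3 * (P.L : ℝ) ^ (l + 1) - 1 := by linarith [one_le_pow₀ (n := l + 1) hL1]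
    have ha := ha₀.le
    positivity
  exact differentiableAt_dbarChartField_zero (n := Fin 2) (by omega) (emlIterU l (unitsField (toUField U₀)))
    (fun c => transfUp (fun x => Unitary.toUnits (suIncl (axialT U₀ (embIter (l + 1) c.src) x)) : GaugeTransf P 0 (Matrix (Fin 2) (Fin 2) ℂ)ˣ) l)
    (fun c x => (norm_transfUp_toUnits_le_one _ l x).1) (fun c x => (norm_transfUp_toUnits_le_one _ l x).2) hρ0 hbudget hsB0 hs₀ρ
    (fun c b h1 h2 => norm_bgTower_gauged_sub_one_le_of_plaqSmall hl U₀ ha₀ hU hbud₀ c b h1 h2)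

end Summit.QuantumFields.YangMills.Theorems.Prop7TwistedOneStepLinL1OfPlaqSmall

end
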